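import Mathlib
import Summits.ValiantsHypothesis.ValiantsHypothesis.Theorems.ProofCarryingSymmetryRestorationQPPCCombPerm
import Summits.ValiantsHypothesis.ValiantsHypothesis.Theorems.ProofCarryingSymmetryRestorationQPPCDeadWeight
import Summits.ValiantsHypothesis.ValiantsHypothesis.Theorems.ProofCarryingSymmetryRestorationQPLayoutNodes

/-!
# Route ProofCarryingSymmetry — crux `RestorationQP`, line `registered`: simulating an automorphism on the layout, one gate at a time

Necessity of the provability stub T′ (`stub_invarianceProvableQP'`), part 4a.  Fix a labelled
Dawar–Wilsenach circuit `D` on a finite gate type, its straight-line layout `B = layoutBody D f P`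
(…ACLayout), a relabelling `ρ` of the variables and a bijection `π` of the gates that is an
ISOMORPHISM from the relabelled circuit onto `D` (children and basis labels preserved, the input
labelled `x` sent to the input labelled `ρ x`).  Writing `Bρ = B.map (rename ρ)` and `F_i`, `Fρ_i`
for the prefix circuits (`PCR.pre`), the GATE LINE of `g` is `Fρ_{out g} = F_{out (π g)}`.
This file realizes the gate line of `g` from the gate lines of its children, in `P_c` over a
commutative ring, at polynomial cost `K = 300·M·(|G|+1)³` (`M` a bound of order `|G|·|B|`):

* leaves (`gateLine_of_var/_of_const`): dead-weight elimination on both sides;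
* fan-in one (`gateLine_of_one`): C2, the child's line, the unit leaf `1` on both sides;
* fan-in `≥ 2` (`gateLine_of_comb`): unsharing the comb (`Real.stepA`), the children's lines
  pointwise, permutation invariance of the comb (`children (π g) = π(children g)` is a SET
  equality, the two enumerations differ by a permutation), re-sharing.

Part 4b assembles the induction over a topological numbering.  Everything proved, no named facts.
-/

-- single-problem summit: `Summit.ValiantsHypothesis.ValiantsHypothesis.…` is the namespace by design (D-0017)
set_option linter.dupNamespace false

noncomputable section

open scoped Classical

namespace Summit.ValiantsHypothesis.ValiantsHypothesis.Theorems

namespace PCR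

open Literature.Computability.AlgebraicComplexity PICircuit ACStability

universe u v

variable {𝔽 : Type u} [CommRing 𝔽] {X : Type v} {Yo : Type*} {G : Type*} [Fintype G]
variable {D : LabelledArithCircuit 𝔽 X Yo G} {f : G → ℕ} {P : ℕ} {ρ : X → X} {π : Equiv.Perm G}

/-- The gate line of `g`: the prefix of the renamed layout at the output node of `g` equals the
prefix of the layout at the output node of `π g`. [folklore] -/
def gateLine (D : LabelledArithCircuit 𝔽 X Yo G) (f : G → ℕ) (P : ℕ) (ρ : X → X) (π : Equiv.Perm G)
    (g : G) : PICircuit 𝔽 X × PICircuit 𝔽 X :=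
  (pre ((layoutBody D f P).map (Node.rename ρ)) (outPos f g), pre (layoutBody D f P) (outPos f (π g)))

/-! ### Bookkeeping -/

section Book

variable (hP : ∀ g, f g < P)
include hP

omit [CommRing 𝔽] in
/-- `1 ≤ out g ≤ |B|`. [folklore] -/
theorem outPos_bounds [Zero 𝔽] [One 𝔽] (g : G) :
    1 ≤ outPos f g ∧ outPos f g ≤ (layoutBody D f P).length := by
  have hb := two_le_bl (G := G)
  refine ⟨by rw [outPos_eq]; omega, ?_⟩
  rw [length_layoutBody, outPos_eq]
  exact (block_index_lt hP g (by omega)).le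

end Book

/-! ### Leaves -/

/-- **Gate line of a variable gate**: both sides are a prefix ending in the leaf `var (ρ x)`;
eliminate the dead weight on both sides (cost `≤ 204 M`). [folklore] -/
theorem gateLine_of_var {L : List (PICircuit 𝔽 X × PICircuit 𝔽 X)} {n : ℕ} (h : Real (pcSystem 𝔽 X) L n)
    (hf : Function.Injective f) (hP : ∀ g, f g < P) {g : G} {x : X} (hl : D.label g = .var x)
    (hπ : D.label (π g) = .var (ρ x)) {M : ℕ} (hM : 3 * (layoutBody D f P).length + 7 ≤ M) :
    Real (pcSystem 𝔽 X) (gateLine D f P ρ π g :: L) (n + 204 * M) := by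
  set B := layoutBody D f P with hB
  set Bρ := B.map (Node.rename ρ) with hBρ
  obtain ⟨h1, h2⟩ := outPos_bounds (D := D) hP g
  obtain ⟨h1', h2'⟩ := outPos_bounds (D := D) hP (π g)
  have hn : B.getD (outPos f (π g)) (.const 0) = .var (ρ x) := getD_layoutBody_outPos_of_var hf hP hπ
  have hnρ : Bρ.getD (outPos f g) (.const 0) = .var (ρ x) := by
    rw [hBρ, getD_map_rename, getD_layoutBody_outPos_of_var hf hP hl]; rfl
  have hlen : Bρ.length = B.length := length_map_rename ρ B
  have r1 := h.preLeaf Bρ h1 (by rw [hlen]; exact h2) (fun k => by rw [hnρ]; rfl) (M := M) (by rw [hlen]; exact hM)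
  have r2 := r1.preLeaf B h1' h2' (fun k => by rw [hn]; rfl) (M := M) hM
  rw [hnρ] at r1 r2; rw [hn] at r2
  have s1 : (pcSystem 𝔽 X).size (pre Bρ (outPos f g)) ≤ M := by
    have := size_pre_le Bρ (outPos f g); simp only [pcSystem]; omega
  have s2 : (pcSystem 𝔽 X).size (pre B (outPos f (π g))) ≤ M := by
    have := size_pre_le B (outPos f (π g)); simp only [pcSystem]; omega
  have s3 : (pcSystem 𝔽 X).size (⟨[], .var (ρ x)⟩ : PICircuit 𝔽 X) ≤ M := by
    simp only [pcSystem, PICircuit.size, List.length_nil]; omega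
  have r3 := r2.symmB List.mem_cons_self s2 s3
  have r4 := r3.transB (List.mem_cons_of_mem _ (List.mem_cons_of_mem _ List.mem_cons_self)) List.mem_cons_self s1 s2
  refine r4.mono (List.cons_subset_cons _ fun e he => ?_) (by omega)
  exact List.mem_cons_of_mem _ (List.mem_cons_of_mem _ (List.mem_cons_of_mem _ he))

/-- **Gate line of a constant gate** (cost `≤ 204 M`). [folklore] -/
theorem gateLine_of_const {L : List (PICircuit 𝔽 X × PICircuit 𝔽 X)} {n : ℕ} (h : Real (pcSystem 𝔽 X) L n)
    (hf : Function.Injective f) (hP : ∀ g, f g < P) {g : G} {c : 𝔽} (hl : D.label g = .const c)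
    (hπ : D.label (π g) = .const c) {M : ℕ} (hM : 3 * (layoutBody D f P).length + 7 ≤ M) :
    Real (pcSystem 𝔽 X) (gateLine D f P ρ π g :: L) (n + 204 * M) := by
  set B := layoutBody D f P with hB
  set Bρ := B.map (Node.rename ρ) with hBρ
  obtain ⟨h1, h2⟩ := outPos_bounds (D := D) hP g
  obtain ⟨h1', h2'⟩ := outPos_bounds (D := D) hP (π g)
  have hn : B.getD (outPos f (π g)) (.const 0) = .const c := getD_layoutBody_outPos_of_const hf hP hπ
  have hnρ : Bρ.getD (outPos f g) (.const 0) = .const c := by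
    rw [hBρ, getD_map_rename, getD_layoutBody_outPos_of_const hf hP hl]; rfl
  have hlen : Bρ.length = B.length := length_map_rename ρ B
  have r1 := h.preLeaf Bρ h1 (by rw [hlen]; exact h2) (fun k => by rw [hnρ]; rfl) (M := M) (by rw [hlen]; exact hM)
  have r2 := r1.preLeaf B h1' h2' (fun k => by rw [hn]; rfl) (M := M) hM
  rw [hnρ] at r1 r2; rw [hn] at r2
  have s1 : (pcSystem 𝔽 X).size (pre Bρ (outPos f g)) ≤ M := by
    have := size_pre_le Bρ (outPos f g); simp only [pcSystem]; omega
  have s2 : (pcSystem 𝔽 X).size (pre B (outPos f (π g))) ≤ M := by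
    have := size_pre_le B (outPos f (π g)); simp only [pcSystem]; omega
  have s3 : (pcSystem 𝔽 X).size (⟨[], .const c⟩ : PICircuit 𝔽 X) ≤ M := by
    simp only [pcSystem, PICircuit.size, List.length_nil]; omega
  have r3 := r2.symmB List.mem_cons_self s2 s3
  have r4 := r3.transB (List.mem_cons_of_mem _ (List.mem_cons_of_mem _ List.mem_cons_self)) List.mem_cons_self s1 s2
  refine r4.mono (List.cons_subset_cons _ fun e he => ?_) (by omega)
  exact List.mem_cons_of_mem _ (List.mem_cons_of_mem _ (List.mem_cons_of_mem _ he))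

/-! ### Children enumerations under the isomorphism -/

omit [CommRing 𝔽] [Fintype G] in
/-- Enumerating the image of a finite set under an embedding: a permutation of the image of the
enumeration. [folklore] -/
theorem toList_map_perm {α β : Type*} (s : Finset α) (e : α ↪ β) :
    (s.map e).toList.Perm (s.toList.map e) := by
  rw [List.perm_ext_iff_of_nodup (Finset.nodup_toList _) ((Finset.nodup_toList s).map e.injective)]
  intro b
  simp [Finset.mem_toList]

omit [CommRing 𝔽] in
/-- Weight of a comb of bounded entries. [folklore] -/
theorem W_le_of_forall {T : Type*} {S : PISystem 𝔽 T} {a : T} {l : List T} {b : ℕ}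
    (ha : S.size a ≤ b) (hl : ∀ x ∈ l, S.size x ≤ b) : W S a l ≤ b + l.length * (b + 1) := by
  induction l with
  | nil => simpa using ha
  | cons x l ih =>
    have hx := hl x List.mem_cons_self
    have ih' := ih fun y hy => hl y (List.mem_cons_of_mem _ hy)
    rw [W_cons]
    unfold W at ih'
    simp only [List.length_cons]
    nlinarith

/-! ### Fan-in one -/

/-- **Gate line of a fan-in-one internal gate**: `t × 1` on both sides — unshare (C2), the
child's gate line, the unit leaf by dead-weight elimination on both sides (cost `≤ 240 M`).
[folklore] -/
theorem gateLine_of_one {L : List (PICircuit 𝔽 X × PICircuit 𝔽 X)} {n : ℕ} (h : Real (pcSystem 𝔽 X) L n)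
    (hf : Function.Injective f) (hmono : ∀ g h : G, h ∈ D.children g → f h < f g) (hP : ∀ g, f g < P)
    {g : G} (hg : ¬ (D.label g).IsInput) (h1 : (D.children g).toList.length = 1)
    (hπc : D.children (π g) = (D.children g).map π.toEmbedding) (hπl : D.label (π g) = D.label g)
    (hkids : ∀ c ∈ D.children g, gateLine D f P ρ π c ∈ L)
    {M : ℕ} (hM : 3 * (layoutBody D f P).length + 7 ≤ M) :
    Real (pcSystem 𝔽 X) (gateLine D f P ρ π g :: L) (n + 240 * M) := by
  set B := layoutBody D f P with hB
  set Bρ := B.map (Node.rename ρ) with hBρ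
  have hb : bl (G := G) = Fintype.card G + 2 := rfl
  have hG : 1 ≤ Fintype.card G := Fintype.card_pos_iff.2 ⟨g⟩
  have hlen : Bρ.length = B.length := length_map_rename ρ B
  have hBl : B.length = P * bl (G := G) := length_layoutBody P
  -- the child
  obtain ⟨c₀, hc₀⟩ := List.length_eq_one_iff.1 h1
  have hcg : D.children g = {c₀} := Finset.toList_eq_singleton_iff.1 hc₀
  have hcπ : D.children (π g) = {π c₀} := by rw [hπc, hcg, Finset.map_singleton]; rfl
  have hc₀mem : c₀ ∈ D.children g := by rw [hcg]; exact Finset.mem_singleton_self _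
  have hπc₀mem : π c₀ ∈ D.children (π g) := by rw [hcπ]; exact Finset.mem_singleton_self _
  have hg' : ¬ (D.label (π g)).IsInput := by rw [hπl]; exact hg
  have h1' : (D.children (π g)).toList.length = 1 := by rw [hcπ, Finset.toList_singleton]; rfl
  have hkp : (kidPos D f g).getD 0 0 = outPos f c₀ := by simp [kidPos, hc₀]
  have hkp' : (kidPos D f (π g)).getD 0 0 = outPos f (π c₀) := by simp [kidPos, hcπ, Finset.toList_singleton]
  -- indices
  set u := f g * bl (G := G) + (bl (G := G) - 2) with hu
  set u' := f (π g) * bl (G := G) + (bl (G := G) - 2) with hu'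
  have hlt1 : outPos f c₀ < outPos f g := by
    have := outPos_lt_of_lt (G := G) (hmono g c₀ hc₀mem); rw [outPos_eq (f := f) g]; omega
  have hlt1' : outPos f (π c₀) < outPos f (π g) := by
    have := outPos_lt_of_lt (G := G) (hmono (π g) (π c₀) hπc₀mem); rw [outPos_eq (f := f) (π g)]; omega
  have hlt2 : u < outPos f g := by rw [outPos_eq]; omega
  have hlt2' : u' < outPos f (π g) := by rw [outPos_eq]; omega
  have hu1 : 1 ≤ u := by omega
  have hu1' : 1 ≤ u' := by omega
  have huB : u ≤ B.length := by rw [hBl]; exact (block_index_lt hP g (by omega)).le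
  have huB' : u' ≤ B.length := by rw [hBl]; exact (block_index_lt hP (π g) (by omega)).le
  -- nodes
  have hn : B.getD (outPos f (π g)) (.const 0) = .mul (outPos f (π c₀)) u' := by
    rw [getD_layoutBody_outPos_of_one hf hP hg' h1', hkp']
  have hnρ : Bρ.getD (outPos f g) (.const 0) = .mul (outPos f c₀) u := by
    rw [hBρ, getD_map_rename, getD_layoutBody_outPos_of_one hf hP hg h1, hkp]; rfl
  have hone : B.getD u' (.const 0) = .const 1 := getD_layoutBody_unit_of_one hf hP hg' h1'
  have honeρ : Bρ.getD u (.const 0) = .const 1 := by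
    rw [hBρ, getD_map_rename, getD_layoutBody_unit_of_one hf hP hg h1]; rfl
  -- sizes
  have hM' : B.length + 1 ≤ M := by omega
  have sz : ∀ i, (pcSystem 𝔽 X).size (pre B i) ≤ M ∧ (pcSystem 𝔽 X).size (pre Bρ i) ≤ M := fun i => by
    have := size_pre_le B i; have := size_pre_le Bρ i; simp only [pcSystem]; omega
  have s1 : (pcSystem 𝔽 X).size (⟨[], .const 1⟩ : PICircuit 𝔽 X) ≤ M := by
    simp only [pcSystem, PICircuit.size, List.length_nil]; omega
  have sm : (pcSystem 𝔽 X).size (PICircuit.mul (pre Bρ (outPos f c₀)) (pre Bρ u)) ≤ 3 * M ∧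
      (pcSystem 𝔽 X).size (PICircuit.mul (pre B (outPos f (π c₀))) (pre B u')) ≤ 3 * M := by
    have := size_pre_le B (outPos f (π c₀)); have := size_pre_le Bρ (outPos f c₀)
    have := size_pre_le B u'; have := size_pre_le Bρ u
    simp only [pcSystem, PICircuit.size_mul]; omega
  -- a1, a2: unshare both output nodes (C2)
  have r1 := h.unshareMul hnρ hlt1 hlt2 (M := M) (by rw [hlen]; exact hM')
  have r2 := r1.unshareMul hn hlt1' hlt2' (M := M) hM'
  -- a3, a4: the unit leaves; a5: (pre Bρ u, pre B u')
  have r3 := r2.preLeaf Bρ hu1 (by rw [hlen]; exact huB) (fun k => by rw [honeρ]; rfl) (M := M) (by rw [hlen]; exact hM)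
  have r4 := r3.preLeaf B hu1' huB' (fun k => by rw [hone]; rfl) (M := M) hM
  rw [honeρ] at r3 r4; rw [hone] at r4
  have r5 := r4.symmB List.mem_cons_self (sz u').1 s1
  have r6 := r5.transB (List.mem_cons_of_mem _ (List.mem_cons_of_mem _ List.mem_cons_self)) List.mem_cons_self
    (sz u).2 (sz u').1
  -- a7: congruence with the child's gate line
  have r7 := r6.congrMulB (B := 3 * M)
    (List.mem_cons_of_mem _ (List.mem_cons_of_mem _ (List.mem_cons_of_mem _ (List.mem_cons_of_mem _
      (List.mem_cons_of_mem _ (List.mem_cons_of_mem _ (hkids c₀ hc₀mem)))))))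
    List.mem_cons_self sm.1 sm.2
  -- a8: symm of a2; chain a1 a7 a8
  have r8 := r7.symmB (B := 3 * M)
    (List.mem_cons_of_mem _ (List.mem_cons_of_mem _ (List.mem_cons_of_mem _ (List.mem_cons_of_mem _
      (List.mem_cons_of_mem _ List.mem_cons_self)))))
    (le_trans (sz _).1 (by omega)) sm.2
  have r9 := r8.trans₃ (B := 3 * M)
    (List.mem_cons_of_mem _ (List.mem_cons_of_mem _ (List.mem_cons_of_mem _ (List.mem_cons_of_mem _
      (List.mem_cons_of_mem _ (List.mem_cons_of_mem _ (List.mem_cons_of_mem _ List.mem_cons_self)))))))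
    (List.mem_cons_of_mem _ List.mem_cons_self) List.mem_cons_self
    (le_trans (sz _).2 (by omega)) sm.2 (le_trans (sz _).1 (by omega))
  refine r9.mono (List.cons_subset_cons _ fun e he => ?_) (by omega)
  iterate 8 apply List.mem_cons_of_mem
  exact he

/-! ### Unsharing the comb of an internal gate of fan-in at least two -/

/-- Entry lists of combs: the first `k+1` of the tail. [folklore] -/
theorem map_drop_take_succ {α β : Type*} (l : List α) (φ : α → β) (d : α) {k : ℕ} (hk : k + 1 < l.length) :
    ((l.map φ).drop 1).take (k + 1) = ((l.map φ).drop 1).take k ++ [φ (l.getD (k + 1) d)] := by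
  have hlen : k < ((l.map φ).drop 1).length := by simp; omega
  rw [List.take_succ_eq_append_getElem hlen, List.getElem_drop, List.getElem_map,
    List.getD_eq_getElem _ _ (by omega)]
  congr 2
  simp only [Nat.add_comm 1 k]

/-- Entry lists of combs: the first entry of the tail. [folklore] -/
theorem map_drop_take_one {α β : Type*} (l : List α) (φ : α → β) (d : α) (h2 : 2 ≤ l.length) :
    ((l.map φ).drop 1).take 1 = [φ (l.getD 1 d)] := by
  have := map_drop_take_succ l φ d (k := 0) (by omega)
  simpa using this

/-- **Step A — unsharing a comb.** In a body `B'` whose block of `g` (fan-in `r ≥ 2`) consists of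
the comb nodes of constructor `mk` (first node `mk kid₀ kid₁`, then `mk (previous) kid_k`), the
prefix at the `k`-th comb node (`1 ≤ k ≤ r - 1`) equals the left comb of the prefixes at the
first `k + 1` children, realized by `k` unsharing steps (cost `≤ 16·M·k`). [folklore] -/
theorem Real.stepA (Kt : OpKit (pcSystem 𝔽 X)) (mk : ℕ → ℕ → Node 𝔽 X) (B' : List (Node 𝔽 X)) (g : G)
    (hun : ∀ {L : List (PICircuit 𝔽 X × PICircuit 𝔽 X)} {n i a b M' : ℕ}, Real (pcSystem 𝔽 X) L n →
      B'.getD i (.const 0) = mk a b → a < i → b < i → B'.length + 1 ≤ M' →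
      Real (pcSystem 𝔽 X) ((pre B' i, Kt.op (pre B' a) (pre B' b)) :: L) (n + 4 * M'))
    (hfirst : B'.getD (f g * bl (G := G) + (bl (G := G) + 1 - (D.children g).toList.length)) (.const 0) =
      mk ((kidPos D f g).getD 0 0) ((kidPos D f g).getD 1 0))
    (hsucc : ∀ k, 2 ≤ k → k < (D.children g).toList.length →
      B'.getD (f g * bl (G := G) + (bl (G := G) + k - (D.children g).toList.length)) (.const 0) =
        mk (f g * bl (G := G) + (bl (G := G) + k - (D.children g).toList.length) - 1) ((kidPos D f g).getD k 0))
    (hkp : ∀ k, k < (D.children g).toList.length → (kidPos D f g).getD k 0 < f g * bl (G := G))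
    (h2 : 2 ≤ (D.children g).toList.length)
    {M : ℕ} (hM1 : B'.length + 1 ≤ M) (hM2 : (D.children g).toList.length * (B'.length + 2) ≤ M) :
    ∀ (k : ℕ), 1 ≤ k → k + 1 ≤ (D.children g).toList.length →
      ∀ {L : List (PICircuit 𝔽 X × PICircuit 𝔽 X)} {n : ℕ}, Real (pcSystem 𝔽 X) L n →
        Real (pcSystem 𝔽 X)
          ((pre B' (f g * bl (G := G) + (bl (G := G) + k - (D.children g).toList.length)),
            comb Kt (pre B' ((kidPos D f g).getD 0 0)) ((((kidPos D f g).map (pre B')).drop 1).take k)) :: L)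
          (n + 16 * M * k) := by
  have hb : bl (G := G) = Fintype.card G + 2 := rfl
  set r := (D.children g).toList.length with hr
  have hrG : r ≤ Fintype.card G := length_toList_children_le (D := D) g
  have hlenkp : (kidPos D f g).length = r := length_kidPos g
  -- size of the combs in play
  have hW : ∀ k, k + 1 ≤ r → W (pcSystem 𝔽 X) (pre B' ((kidPos D f g).getD 0 0))
      ((((kidPos D f g).map (pre B')).drop 1).take k) ≤ M := by
    intro k hk
    refine (W_le_of_forall (b := B'.length + 1) (size_pre_le B' _) fun x hx => ?_).trans ?_
    · obtain ⟨i, -, rfl⟩ := List.mem_map.1 (List.mem_of_mem_drop (List.mem_of_mem_take hx))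
      exact size_pre_le B' i
    · have hl : ((((kidPos D f g).map (pre B')).drop 1).take k).length ≤ r - 1 := by
        simp only [List.length_take, List.length_drop, List.length_map, hlenkp]; omega
      calc B'.length + 1 + ((((kidPos D f g).map (pre B')).drop 1).take k).length * (B'.length + 1 + 1)
          ≤ B'.length + 1 + (r - 1) * (B'.length + 2) := by nlinarith
        _ ≤ r * (B'.length + 2) := by
            have : 1 ≤ r := by omega
            calc B'.length + 1 + (r - 1) * (B'.length + 2) ≤ (B'.length + 2) + (r - 1) * (B'.length + 2) := by omega
              _ = (1 + (r - 1)) * (B'.length + 2) := by ring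
              _ = r * (B'.length + 2) := by rw [Nat.add_sub_cancel' this]
        _ ≤ M := hM2
  intro k
  induction k with
  | zero => intro h0; exact absurd h0 (by norm_num)
  | succ k ih =>
    intro _ hk L n h
    rcases Nat.eq_zero_or_pos k with rfl | hkpos
    · -- k + 1 = 1: the first comb node
      have r1 := hun h hfirst (by have := hkp 0 (by omega); omega) (by have := hkp 1 (by omega); omega) hM1
      rw [map_drop_take_one _ _ 0 (by rw [hlenkp]; omega)]
      rw [show bl (G := G) + 1 - r = bl (G := G) + (0 + 1) - r from rfl] at r1
      refine r1.mono (List.Subset.refl _) (by omega)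
    · -- k + 1 ≥ 2: one more unsharing step on top of the line for `k`
      have r0 := ih hkpos (by omega) h
      have hnode := hsucc (k + 1) (by omega) (by omega)
      have hidx : f g * bl (G := G) + (bl (G := G) + (k + 1) - r) - 1 = f g * bl (G := G) + (bl (G := G) + k - r) := by
        omega
      rw [hidx] at hnode
      have r1 := hun r0 hnode (by omega) (by have := hkp (k + 1) (by omega); omega) hM1
      -- congruence with the line for `k`, then transitivity
      have sz1 : (pcSystem 𝔽 X).size (pre B' ((kidPos D f g).getD (k + 1) 0)) ≤ M :=
        (size_pre_le B' _).trans hM1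
      have hWk := hW k (by omega)
      have hWk1 := hW (k + 1) hk
      rw [map_drop_take_succ _ _ 0 (by rw [hlenkp]; omega)] at hWk1 ⊢
      have sz2 : (pcSystem 𝔽 X).size (Kt.op (pre B' (f g * bl (G := G) + (bl (G := G) + k - r)))
          (pre B' ((kidPos D f g).getD (k + 1) 0))) ≤ 3 * M := by
        rw [Kt.size_op]
        have h1 := size_pre_le B' (f g * bl (G := G) + (bl (G := G) + k - r))
        have h2 := size_pre_le B' ((kidPos D f g).getD (k + 1) 0)
        simp only [pcSystem]; omega
      have sz3 : (pcSystem 𝔽 X).size (Kt.op (comb Kt (pre B' ((kidPos D f g).getD 0 0))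
          ((((kidPos D f g).map (pre B')).drop 1).take k)) (pre B' ((kidPos D f g).getD (k + 1) 0))) ≤ 2 * M := by
        have e : Kt.op (comb Kt (pre B' ((kidPos D f g).getD 0 0)) ((((kidPos D f g).map (pre B')).drop 1).take k))
            (pre B' ((kidPos D f g).getD (k + 1) 0)) = comb Kt (pre B' ((kidPos D f g).getD 0 0))
            ((((kidPos D f g).map (pre B')).drop 1).take k ++ [pre B' ((kidPos D f g).getD (k + 1) 0)]) := by
          rw [comb_append, comb_cons, comb_nil]
        rw [e, size_comb]; omega
      have r2 := r1.reflB _ sz1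
      have r3 := Kt.congr r2 (List.mem_cons_of_mem _ (List.mem_cons_of_mem _ List.mem_cons_self)) List.mem_cons_self
      have r4 := r3.trans (List.mem_cons_of_mem _ (List.mem_cons_of_mem _ List.mem_cons_self)) List.mem_cons_self
      have e : Kt.op (comb Kt (pre B' ((kidPos D f g).getD 0 0)) ((((kidPos D f g).map (pre B')).drop 1).take k))
          (pre B' ((kidPos D f g).getD (k + 1) 0)) = comb Kt (pre B' ((kidPos D f g).getD 0 0))
          ((((kidPos D f g).map (pre B')).drop 1).take k ++ [pre B' ((kidPos D f g).getD (k + 1) 0)]) := by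
        rw [comb_append, comb_cons, comb_nil]
      rw [e] at r4
      have sz4 : (pcSystem 𝔽 X).size (pre B' (f g * bl (G := G) + (bl (G := G) + (k + 1) - r))) ≤ M :=
        (size_pre_le B' _).trans hM1
      refine r4.mono (List.cons_subset_cons _ fun e he => ?_) ?_
      · exact List.mem_cons_of_mem _ (List.mem_cons_of_mem _ (List.mem_cons_of_mem _ (List.mem_cons_of_mem _ he)))
      · rw [e] at sz3
        have : (pcSystem 𝔽 X).size (comb Kt (pre B' ((kidPos D f g).getD 0 0))
            ((((kidPos D f g).map (pre B')).drop 1).take k ++ [pre B' ((kidPos D f g).getD (k + 1) 0)])) ≤ M := by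
          rw [size_comb]; exact hWk1
        have hM0 : 0 ≤ M := Nat.zero_le _
        have hk16 : 16 * M * (k + 1) = 16 * M * k + 16 * M := by ring
        rw [hk16]
        linarith [sz1, sz2, sz3, sz4, this]

end PCR

open Literature.Computability.AlgebraicComplexity in
/-- **Gate line of a variable gate, `P_c(ℂ)` form** (registered helper toward the necessity of
stub T′ `stub_invarianceProvableQP'`, crux `RestorationQP`): in the straight-line layout of a
labelled circuit, for a gate labelled `x` sent by `π` to the gate labelled `ρ x`, the line
"prefix of the `ρ`-renamed layout at `out g` = prefix of the layout at `out (π g)`" is realized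
inside any proof DAG at cost `204 M`. [folklore] -/
theorem invarianceProvableQP_aux_gateLineVar : ∀ (n : ℕ) (G : Type) [Fintype G] (D : LabelledArithCircuit ℂ (Fin n × Fin n) Unit G) (f : G → ℕ) (P : ℕ) (ρ : Fin n × Fin n → Fin n × Fin n) (π : Equiv.Perm G) (L : List (PICircuit ℂ (Fin n × Fin n) × PICircuit ℂ (Fin n × Fin n))) (m M : ℕ) (g : G) (x : Fin n × Fin n), PCR.Real (pcSystem ℂ (Fin n × Fin n)) L m → Function.Injective f → (∀ g' : G, f g' < P) → D.label g = CircuitLabel.var x → D.label (π g) = CircuitLabel.var (ρ x) → 3 * (ACStability.layoutBody D f P).length + 7 ≤ M → PCR.Real (pcSystem ℂ (Fin n × Fin n)) ((PCR.pre ((ACStability.layoutBody D f P).map (PICircuit.Node.rename ρ)) (ACStability.outPos f g), PCR.pre (ACStability.layoutBody D f P) (ACStability.outPos f (π g))) :: L) (m + 204 * M) := by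
  intro n G _ D f P ρ π L m M g x h hf hP hl hπ hM
  exact PCR.gateLine_of_var h hf hP hl hπ hM

end Summit.ValiantsHypothesis.ValiantsHypothesis.Theorems

end
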